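import Mathlib.Analysis.Complex.Exponential
import Mathlib.Analysis.SpecialFunctions.Trigonometric.Bounds
import Mathlib.Analysis.SpecialFunctions.Log.Deriv
import Mathlib.Analysis.SpecialFunctions.Complex.Log
import Mathlib.Analysis.SpecialFunctions.Complex.Arctan
import Mathlib.Analysis.SpecialFunctions.Trigonometric.Arctan
import Literature.Analysis.ValidatedNumerics.FixedPointInterval
import HarnessLib

/-!
# Multi-precision fixed-point interval arithmetic over `ℝ` and `ℂ`

Trunk T-ANA (Analysis/ValidatedNumerics). A verified numerics engine in the style of the tree's
`FixedPointInterval.lean` (`Literature.Analysis.ValidatedNumerics.Numerics.FI`, binary scale fixed at `2^48`), but with the scale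
`S` (any positive integer; in practice `2^p`) a *parameter* of the membership predicate and of the
few operations that need it (`ofInt`, `ofFrac`, `mul`, `divPos`, `rescale` and the transcendental
enclosures). This is what certified computations at 60–90 decimal digits require — the motivating
use is the certified evaluation of `ζ(½ + it)` near its first 2000 zeros to `2^-240`
(Odlyzko–te Riele's disproof of the Mertens conjecture, `MertensConjectureDisproof.lean`), where the
ordinates enter phases `γ y` with `|y| ≈ 1.4 · 10⁶⁴`.

Intervals `⟨lo, hi⟩ : MI` with integer endpoints stand for `[lo/S, hi/S] ⊂ ℝ`
(`MI.mem S x I`); boxes `MC` are pairs of intervals (`MC.mem S z B`). All operations are total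
computable functions on `ℤ` (partial ones return `Option`), rounded outward, each with an
inclusion theorem; the term counts of the Taylor/series enclosures are parameters, so that the
same code serves `S = 2^64` and `S = 2^300`.

## Main definitions (namespace `Literature.NumericsMP`)

* `MI`, `MI.mem S`; `MI.ofInt/ofScaled/ofFrac/add/sub/neg/mul/sqr/mulInt/divNat/divPos/absHi/
  widen/hull/span/rescale/lower/upper`.
* `MC`, `MC.mem S`; `MC.add/sub/neg/conj/mul/sqr/mulMI/mulI/mulInt/divNat/normSq/divBox/widen`.
* `MI.expSmallPt S K` (`exp` on `[-1,1]`, `K` Taylor terms), `MI.expPt S K k`, `MI.exp S K k`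
  (range reduction `e^x = (e^{x/2^k})^{2^k}`), `MI.logOneSub S K` (`log(1-x)`, `0 ≤ x ≤ ½`),
  `MI.logTwo S K`, `MI.logNat S K n`, `MI.atanInv S K m` (`arctan (1/m)`), `MI.pi S K` (Machin),
  `MC.expISmallPt S K`, `MC.expI S K piI` (`θ ↦ e^{iθ}` with argument reduction by a supplied
  enclosure of `π`).

## Main results

* `MI.mem_add`, `mem_mul`, `mem_divPos`, `mem_rescale`, …, `MC.mem_mul`, `MC.mem_divBox`, …;
* `MI.mem_expSmallPt`, `MI.mem_exp`, `MI.mem_logOneSub`, `MI.mem_logNat`, `MI.mem_atanInv`,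
  `MI.mem_pi`, `MC.mem_expI` — inclusion theorems for the transcendental enclosures
  (`Real.exp_bound`, `Complex.exp_bound`, `Real.abs_log_sub_add_sum_range_le`, `Real.hasSum_arctan`
  with a geometric tail bound, `Real.four_mul_arctan_inv_5_sub_arctan_inv_239`).

## References

* R. E. Moore, *Interval Analysis*, Prentice-Hall 1966, Ch. 2–4 (inclusion property, outward
  rounding, interval extensions of elementary functions). [folklore]
* The tree's `Literature/Analysis/ValidatedNumerics/FixedPointInterval.lean` (same design at the
  fixed scale `2^48`; the proofs below follow it, and its scale-free helpers `Literature.Analysis.ValidatedNumerics.Numerics.cdiv`,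
  `fdiv_mul_le_real`, `le_cdiv_mul_real`, `fdiv_le_div`, `div_le_cdiv`, `FI.mul_mem_corners`,
  `CB.norm_exp_I_sub_exp_I_le` are reused, not restated).

## Refactor item (for the librarian)

`FI := MI at SC`: `Literature.Analysis.ValidatedNumerics.Numerics.FI`/`CB` and their operations are the instances `S = 2^48` of
`MI`/`MC` below; downstream kernel certificates currently depend on the exact definitions of
`FixedPointInterval.lean`, so the two engines are kept in parallel for now and should be merged
(the fixed-scale file becoming a thin specialisation) so that they do not drift.
-/

open Real Complex Finset

namespace Literature.Analysis.ValidatedNumerics.NumericsMP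

/-! ### Floor and ceiling division

The ceiling division `cdiv` and its four rounding lemmas are those of `FixedPointInterval.lean`
(`Literature.Numerics`), re-exported here. -/

export Numerics (cdiv fdiv_mul_le_real le_cdiv_mul_real fdiv_le_div div_le_cdiv)

/-! ### Real intervals at scale `S` -/

/-- A real interval with integer endpoints at scale `S`: `⟨lo, hi⟩` stands for `[lo/S, hi/S]`.
[folklore] -/
structure MI where
  /-- scaled lower endpoint -/
  lo : ℤ
  /-- scaled upper endpoint -/
  hi : ℤ
  deriving DecidableEq, Repr, Inhabited

namespace MI

/-- `x ∈ I` at scale `S` : `lo ≤ x · S ≤ hi`. [folklore] -/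
def mem (S : ℕ) (x : ℝ) (I : MI) : Prop := (I.lo : ℝ) ≤ x * S ∧ x * S ≤ (I.hi : ℝ)

/-- The point interval of an integer. [folklore] -/
def ofInt (S : ℕ) (n : ℤ) : MI := ⟨n * S, n * S⟩

/-- The thin interval with scaled value `k`, i.e. the number `k/S`. [folklore] -/
def ofScaled (k : ℤ) : MI := ⟨k, k⟩

/-- An enclosure of the fraction `p/q` (`q > 0`). [folklore] -/
def ofFrac (S : ℕ) (p : ℤ) (q : ℕ) : MI := ⟨p * S / q, Numerics.cdiv (p * S) q⟩

/-- Sum. [folklore] -/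
def add (I J : MI) : MI := ⟨I.lo + J.lo, I.hi + J.hi⟩

/-- Negation. [folklore] -/
def neg (I : MI) : MI := ⟨-I.hi, -I.lo⟩

/-- Difference. [folklore] -/
def sub (I J : MI) : MI := ⟨I.lo - J.hi, I.hi - J.lo⟩

/-- Product (Moore product, outward rounded to scale `S`). [folklore] -/
def mul (S : ℕ) (I J : MI) : MI :=
  let p1 := I.lo * J.lo
  let p2 := I.lo * J.hi
  let p3 := I.hi * J.lo
  let p4 := I.hi * J.hi
  ⟨min (min p1 p2) (min p3 p4) / S, Numerics.cdiv (max (max p1 p2) (max p3 p4)) S⟩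

/-- Square. [folklore] -/
def sqr (S : ℕ) (I : MI) : MI := mul S I I

/-- Product with an integer (exact). [folklore] -/
def mulInt (I : MI) (k : ℤ) : MI := if 0 ≤ k then ⟨I.lo * k, I.hi * k⟩ else ⟨I.hi * k, I.lo * k⟩

/-- Division by a positive natural number. [folklore] -/
def divNat (I : MI) (n : ℕ) : MI := ⟨I.lo / n, Numerics.cdiv I.hi n⟩

/-- Division by an interval with positive lower endpoint (`none` otherwise). [folklore] -/
def divPos (S : ℕ) (I J : MI) : Option MI :=
  if 0 < J.lo then
    some ⟨if 0 ≤ I.lo then I.lo * S / J.hi else I.lo * S / J.lo,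
      if 0 ≤ I.hi then Numerics.cdiv (I.hi * S) J.lo else Numerics.cdiv (I.hi * S) J.hi⟩
  else none

/-- An upper bound for `|x| · S` on the interval. [folklore] -/
def absHi (I : MI) : ℤ := max |I.lo| |I.hi|

/-- Symmetric widening by the non-negative scaled amount `e`. [folklore] -/
def widen (I : MI) (e : ℤ) : MI := ⟨I.lo - e, I.hi + e⟩

/-- Convex hull of two intervals. [folklore] -/
def hull (I J : MI) : MI := ⟨min I.lo J.lo, max I.hi J.hi⟩

/-- The interval `[lo(I), hi(J)]` (used for monotone functions). [folklore] -/
def span (I J : MI) : MI := ⟨I.lo, J.hi⟩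

/-- The thin interval at the lower endpoint. [folklore] -/
def lower (I : MI) : MI := ⟨I.lo, I.lo⟩

/-- The thin interval at the upper endpoint. [folklore] -/
def upper (I : MI) : MI := ⟨I.hi, I.hi⟩

/-- Change of scale: from scale `S` to scale `S'` (outward rounded). [folklore] -/
def rescale (S S' : ℕ) (I : MI) : MI := ⟨I.lo * S' / S, Numerics.cdiv (I.hi * S') S⟩

/-! #### Inclusion theorems -/

variable {S : ℕ} {x y : ℝ} {I J : MI}

/-- [folklore] -/
lemma mem_def : mem S x I ↔ (I.lo : ℝ) ≤ x * S ∧ x * S ≤ (I.hi : ℝ) := Iff.rfl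

/-- [folklore] -/
theorem mem_ofInt (S : ℕ) (n : ℤ) : mem S (n : ℝ) (ofInt S n) := by
  simp [mem, ofInt]

/-- [folklore] -/
theorem mem_ofScaled (hS : 0 < S) (k : ℤ) : mem S ((k : ℝ) / S) (ofScaled k) := by
  have : (S : ℝ) ≠ 0 := by positivity
  simp [mem, ofScaled, div_mul_cancel₀ _ this]

/-- [folklore] -/
theorem mem_ofFrac (S : ℕ) (p : ℤ) {q : ℕ} (hq : 0 < q) : mem S ((p : ℝ) / q) (ofFrac S p q) := by
  have hq' : (0 : ℤ) < q := by exact_mod_cast hq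
  constructor
  · have h := Numerics.fdiv_le_div (a := p * S) hq'
    simp only [ofFrac, Int.cast_mul, Int.cast_natCast] at h ⊢
    rw [div_mul_eq_mul_div]; exact h
  · have h := Numerics.div_le_cdiv (a := p * S) hq'
    simp only [ofFrac, Int.cast_mul, Int.cast_natCast] at h ⊢
    rw [div_mul_eq_mul_div]; exact h

/-- [folklore] -/
theorem mem_add (hx : mem S x I) (hy : mem S y J) : mem S (x + y) (add I J) := by
  simp only [mem, add, Int.cast_add] at hx hy ⊢
  constructor <;> nlinarith [hx.1, hx.2, hy.1, hy.2]

/-- [folklore] -/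
theorem mem_neg (hx : mem S x I) : mem S (-x) (neg I) := by
  simp only [mem, neg, Int.cast_neg] at hx ⊢
  constructor <;> linarith [hx.1, hx.2]

/-- [folklore] -/
theorem mem_sub (hx : mem S x I) (hy : mem S y J) : mem S (x - y) (sub I J) := by
  simp only [mem, sub, Int.cast_sub] at hx hy ⊢
  constructor <;> linarith [hx.1, hx.2, hy.1, hy.2]

/-- [folklore] -/
theorem mem_mul (hS : 0 < S) (hx : mem S x I) (hy : mem S y J) : mem S (x * y) (mul S I J) := by
  have hSr : (0 : ℝ) < S := by exact_mod_cast hS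
  have hSz : (0 : ℤ) < S := by exact_mod_cast hS
  obtain ⟨h1, h2⟩ := Literature.Analysis.ValidatedNumerics.Numerics.FI.mul_mem_corners hx hy
  have hxy : x * S * (y * S) = x * y * S * S := by ring
  rw [hxy] at h1 h2
  simp only [mem, mul]
  constructor
  · have h := Numerics.fdiv_mul_le_real (a := min (min (I.lo * J.lo) (I.lo * J.hi))
      (min (I.hi * J.lo) (I.hi * J.hi))) hSz
    push_cast at h
    nlinarith
  · have h := Numerics.le_cdiv_mul_real (a := max (max (I.lo * J.lo) (I.lo * J.hi))
      (max (I.hi * J.lo) (I.hi * J.hi))) hSz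
    push_cast at h
    nlinarith

/-- [folklore] -/
theorem mem_sqr (hS : 0 < S) (hx : mem S x I) : mem S (x ^ 2) (sqr S I) := by
  rw [sq]; exact mem_mul hS hx hx

/-- [folklore] -/
theorem mem_mulInt (hx : mem S x I) (k : ℤ) : mem S (x * k) (mulInt I k) := by
  simp only [mem, mulInt] at hx ⊢
  split_ifs with hk
  · have hk' : (0 : ℝ) ≤ k := by exact_mod_cast hk
    simp only [Int.cast_mul]
    constructor <;> nlinarith [hx.1, hx.2]
  · have hk' : (k : ℝ) ≤ 0 := by exact_mod_cast (not_le.1 hk).le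
    simp only [Int.cast_mul]
    constructor <;> nlinarith [hx.1, hx.2]

/-- [folklore] -/
theorem mem_divNat (hx : mem S x I) {n : ℕ} (hn : 0 < n) : mem S (x / n) (divNat I n) := by
  have hn' : (0 : ℤ) < n := by exact_mod_cast hn
  have hnr : (0 : ℝ) < n := by exact_mod_cast hn
  simp only [mem, divNat] at hx ⊢
  constructor
  · have h := Numerics.fdiv_le_div (a := I.lo) hn'
    simp only [Int.cast_natCast] at h
    rw [div_mul_eq_mul_div, le_div_iff₀ hnr]
    calc ((I.lo / n : ℤ) : ℝ) * n ≤ (I.lo : ℝ) / n * n := by gcongr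
      _ = I.lo := by field_simp
      _ ≤ x * S := hx.1
  · have h := Numerics.div_le_cdiv (a := I.hi) hn'
    simp only [Int.cast_natCast] at h
    rw [div_mul_eq_mul_div, div_le_iff₀ hnr]
    calc x * S ≤ I.hi := hx.2
      _ = (I.hi : ℝ) / n * n := by field_simp
      _ ≤ ((Numerics.cdiv I.hi n : ℤ) : ℝ) * n := by gcongr

/-- [folklore] -/
theorem mem_divPos (hS : 0 < S) {K : MI} (h : divPos S I J = some K) (hx : mem S x I)
    (hy : mem S y J) : mem S (x / y) K := by
  have hSr : (0 : ℝ) < S := by exact_mod_cast hS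
  unfold divPos at h
  by_cases hJ : 0 < J.lo
  · rw [if_pos hJ, Option.some.injEq] at h
    subst h
    have hJr : (0 : ℝ) < J.lo := by exact_mod_cast hJ
    obtain ⟨hy1, hy2⟩ := hy
    obtain ⟨hx1, hx2⟩ := hx
    have hyS : 0 < y * S := lt_of_lt_of_le hJr hy1
    have key : x / y * S = (x * S) * S / (y * S) := by
      field_simp
    have hJhi : (0 : ℝ) < J.hi := lt_of_lt_of_le hyS hy2
    have hJhi' : (0 : ℤ) < J.hi := by exact_mod_cast hJhi
    have lo1 : 0 ≤ I.lo → ((I.lo * S / J.hi : ℤ) : ℝ) ≤ x / y * S := by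
      intro h0
      have h0' : (0 : ℝ) ≤ I.lo := by exact_mod_cast h0
      have h := Numerics.fdiv_le_div (a := I.lo * S) hJhi'
      push_cast at h
      rw [key]
      refine h.trans ?_
      rw [div_le_div_iff₀ hJhi hyS]
      have : (I.lo : ℝ) * S * (y * S) ≤ (I.lo : ℝ) * S * J.hi := by
        apply mul_le_mul_of_nonneg_left hy2; positivity
      nlinarith [mul_le_mul_of_nonneg_right hx1 (le_of_lt hJhi)]
    have lo2 : ¬ 0 ≤ I.lo → ((I.lo * S / J.lo : ℤ) : ℝ) ≤ x / y * S := by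
      intro h0
      have h0' : (I.lo : ℝ) < 0 := by exact_mod_cast (not_le.1 h0)
      have h := Numerics.fdiv_le_div (a := I.lo * S) hJ
      push_cast at h
      rw [key]
      refine h.trans ?_
      rw [div_le_div_iff₀ hJr hyS]
      have e1 : (I.lo : ℝ) * S * (y * S) ≤ (I.lo : ℝ) * S * J.lo := by
        have : (I.lo : ℝ) * S ≤ 0 := by nlinarith
        exact mul_le_mul_of_nonpos_left hy1 this
      nlinarith [mul_le_mul_of_nonneg_right hx1 (le_of_lt hJr)]
    have hi1 : 0 ≤ I.hi → x / y * S ≤ ((Numerics.cdiv (I.hi * S) J.lo : ℤ) : ℝ) := by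
      intro h0
      have h0' : (0 : ℝ) ≤ I.hi := by exact_mod_cast h0
      have h := Numerics.div_le_cdiv (a := I.hi * S) hJ
      push_cast at h
      rw [key]
      refine le_trans ?_ h
      rw [div_le_div_iff₀ hyS hJr]
      have e1 : (I.hi : ℝ) * S * J.lo ≤ (I.hi : ℝ) * S * (y * S) := by
        apply mul_le_mul_of_nonneg_left hy1; positivity
      nlinarith [mul_le_mul_of_nonneg_right hx2 (le_of_lt hJr)]
    have hi2 : ¬ 0 ≤ I.hi → x / y * S ≤ ((Numerics.cdiv (I.hi * S) J.hi : ℤ) : ℝ) := by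
      intro h0
      have h0' : (I.hi : ℝ) < 0 := by exact_mod_cast (not_le.1 h0)
      have h := Numerics.div_le_cdiv (a := I.hi * S) hJhi'
      push_cast at h
      rw [key]
      refine le_trans ?_ h
      rw [div_le_div_iff₀ hyS hJhi]
      have e1 : (I.hi : ℝ) * S * J.hi ≤ (I.hi : ℝ) * S * (y * S) := by
        have : (I.hi : ℝ) * S ≤ 0 := by nlinarith
        exact mul_le_mul_of_nonpos_left hy2 this
      nlinarith [mul_le_mul_of_nonneg_right hx2 (le_of_lt hJhi)]
    simp only [mem]
    constructor
    · split_ifs with h0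
      · exact lo1 h0
      · exact lo2 h0
    · split_ifs with h0
      · exact hi1 h0
      · exact hi2 h0
  · rw [if_neg hJ] at h
    simp at h

/-- [folklore] -/
theorem abs_le_absHi (hx : mem S x I) : |x| * S ≤ (absHi I : ℝ) := by
  simp only [mem] at hx
  simp only [absHi, Int.cast_max, Int.cast_abs]
  have hS0 : (0 : ℝ) ≤ S := by positivity
  rw [← abs_of_nonneg hS0, ← abs_mul]
  rcases le_total 0 (x * S) with h | h
  · rw [abs_of_nonneg h]
    exact le_max_of_le_right (hx.2.trans (le_abs_self _))
  · rw [abs_of_nonpos h]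
    exact le_max_of_le_left (by linarith [neg_abs_le (I.lo : ℝ)])

/-- Membership transported along an error bound: if `x ∈ I` and `|x' - x| · S ≤ e` then
`x' ∈ widen I e`. [folklore] -/
theorem mem_widen (hx : mem S x I) {x' : ℝ} {e : ℤ} (he : |x' - x| * S ≤ e) :
    mem S x' (widen I e) := by
  simp only [mem, widen, Int.cast_sub, Int.cast_add] at hx ⊢
  have hS0 : (0 : ℝ) ≤ S := by positivity
  have h1 : |x' - x| * S = |x' * S - x * S| := by
    rw [← sub_mul, abs_mul, abs_of_nonneg hS0]
  rw [h1] at he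
  have := abs_le.1 he
  constructor <;> linarith [this.1, this.2, hx.1, hx.2]

/-- Widening by a non-negative amount keeps members. [folklore] -/
theorem mem_widen_self (hx : mem S x I) {e : ℤ} (he : 0 ≤ e) : mem S x (widen I e) :=
  mem_widen hx (by simpa using (show (0 : ℝ) ≤ e by exact_mod_cast he))

/-- [folklore] -/
theorem mem_hull_left (hx : mem S x I) (J : MI) : mem S x (hull I J) := by
  simp only [mem, hull, Int.cast_min, Int.cast_max] at hx ⊢
  exact ⟨(min_le_left _ _).trans hx.1, hx.2.trans (le_max_left _ _)⟩

/-- [folklore] -/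
theorem mem_hull_right (hx : mem S x J) (I : MI) : mem S x (hull I J) := by
  simp only [mem, hull, Int.cast_min, Int.cast_max] at hx ⊢
  exact ⟨(min_le_right _ _).trans hx.1, hx.2.trans (le_max_right _ _)⟩

/-- A value between a member of `I` and a member of `J` lies in `span I J`. [folklore] -/
theorem mem_span {u v : ℝ} (hu : mem S u I) (hv : mem S v J) (h1 : u ≤ x) (h2 : x ≤ v) :
    mem S x (span I J) := by
  simp only [mem, span] at hu hv ⊢
  have hS0 : (0 : ℝ) ≤ S := by positivity
  constructor <;> nlinarith [hu.1, hv.2]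

/-- The lower endpoint, as a real, is a member of `lower I`. [folklore] -/
theorem mem_lower (hS : 0 < S) (I : MI) : mem S ((I.lo : ℝ) / S) (lower I) :=
  mem_ofScaled hS I.lo

/-- The upper endpoint, as a real, is a member of `upper I`. [folklore] -/
theorem mem_upper (hS : 0 < S) (I : MI) : mem S ((I.hi : ℝ) / S) (upper I) :=
  mem_ofScaled hS I.hi

/-- `lo ≤ hi` for an inhabited interval. [folklore] -/
theorem lo_le_hi (hx : mem S x I) : I.lo ≤ I.hi := by
  have := hx.1.trans hx.2
  exact_mod_cast this

/-- Reading a sign off the endpoints. [folklore] -/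
theorem pos_of_lo_pos (hx : mem S x I) (h : 0 < I.lo) : 0 < x := by
  have h' : (0 : ℝ) < I.lo := by exact_mod_cast h
  have := lt_of_lt_of_le h' hx.1
  have hS0 : (0 : ℝ) ≤ S := by positivity
  by_contra hx0
  push Not at hx0
  nlinarith

/-- [folklore] -/
theorem neg_of_hi_neg (hx : mem S x I) (h : I.hi < 0) : x < 0 := by
  have h' : (I.hi : ℝ) < 0 := by exact_mod_cast h
  have := lt_of_le_of_lt hx.2 h'
  have hS0 : (0 : ℝ) ≤ S := by positivity
  by_contra hx0
  push Not at hx0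
  nlinarith

/-- [folklore] -/
theorem lt_of_hi_lt_lo (hx : mem S x I) (hy : mem S y J) (h : I.hi < J.lo) : x < y := by
  have h' : (I.hi : ℝ) < J.lo := by exact_mod_cast h
  have := lt_of_le_of_lt hx.2 (lt_of_lt_of_le h' hy.1)
  have hS0 : (0 : ℝ) ≤ S := by positivity
  by_contra hxy
  push Not at hxy
  nlinarith

/-- Lower endpoint as a real bound. [folklore] -/
theorem lo_div_le (hS : 0 < S) (hx : mem S x I) : (I.lo : ℝ) / S ≤ x := by
  rw [div_le_iff₀ (by exact_mod_cast hS)]; exact hx.1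

/-- Upper endpoint as a real bound. [folklore] -/
theorem le_hi_div (hS : 0 < S) (hx : mem S x I) : x ≤ (I.hi : ℝ) / S := by
  rw [le_div_iff₀ (by exact_mod_cast hS)]; exact hx.2

/-- A real bound `x ≤ q` from `hi ≤ q · S` (`q` an integer). [folklore] -/
theorem le_of_hi_le (hS : 0 < S) (hx : mem S x I) {q : ℤ} (h : I.hi ≤ q * S) : x ≤ q := by
  have h' : (I.hi : ℝ) ≤ q * S := by exact_mod_cast h
  have hSr : (0 : ℝ) < S := by exact_mod_cast hS
  nlinarith [hx.2]

/-- [folklore] -/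
theorem mem_rescale (hS : 0 < S) (S' : ℕ) (hx : mem S x I) : mem S' x (rescale S S' I) := by
  have hSz : (0 : ℤ) < S := by exact_mod_cast hS
  have hSr : (0 : ℝ) < S := by exact_mod_cast hS
  have hS'0 : (0 : ℝ) ≤ S' := by positivity
  simp only [mem, rescale]
  constructor
  · have h := Numerics.fdiv_le_div (a := I.lo * S') hSz
    push_cast at h
    refine h.trans ?_
    rw [div_le_iff₀ hSr]
    nlinarith [hx.1]
  · have h := Numerics.div_le_cdiv (a := I.hi * S') hSz
    push_cast at h
    refine le_trans ?_ h
    rw [le_div_iff₀ hSr]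
    nlinarith [hx.2]

end MI

/-! ### Complex boxes -/

/-- A complex box: real and imaginary parts in intervals at a common scale. [folklore] -/
structure MC where
  /-- enclosure of the real part -/
  re : MI
  /-- enclosure of the imaginary part -/
  im : MI
  deriving DecidableEq, Repr, Inhabited

namespace MC

/-- `z ∈ B` at scale `S`. [folklore] -/
def mem (S : ℕ) (z : ℂ) (B : MC) : Prop := MI.mem S z.re B.re ∧ MI.mem S z.im B.im

/-- [folklore] -/
def ofMI (S : ℕ) (I : MI) : MC := ⟨I, MI.ofInt S 0⟩
/-- [folklore] -/
def ofInt (S : ℕ) (n : ℤ) : MC := ⟨MI.ofInt S n, MI.ofInt S 0⟩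
/-- The box with given parts. [folklore] -/
def mk' (re im : MI) : MC := ⟨re, im⟩
/-- [folklore] -/
def add (A B : MC) : MC := ⟨A.re.add B.re, A.im.add B.im⟩
/-- [folklore] -/
def sub (A B : MC) : MC := ⟨A.re.sub B.re, A.im.sub B.im⟩
/-- [folklore] -/
def neg (A : MC) : MC := ⟨A.re.neg, A.im.neg⟩
/-- [folklore] -/
def conj (A : MC) : MC := ⟨A.re, A.im.neg⟩
/-- [folklore] -/
def mul (S : ℕ) (A B : MC) : MC :=
  ⟨(A.re.mul S B.re).sub (A.im.mul S B.im), (A.re.mul S B.im).add (A.im.mul S B.re)⟩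
/-- [folklore] -/
def sqr (S : ℕ) (A : MC) : MC := mul S A A
/-- Product with a real interval. [folklore] -/
def mulMI (S : ℕ) (A : MC) (I : MI) : MC := ⟨A.re.mul S I, A.im.mul S I⟩
/-- Product with `i`. [folklore] -/
def mulI (A : MC) : MC := ⟨A.im.neg, A.re⟩
/-- Product with `-i`. [folklore] -/
def mulNegI (A : MC) : MC := ⟨A.im, A.re.neg⟩
/-- Product with an integer. [folklore] -/
def mulInt (A : MC) (k : ℤ) : MC := ⟨A.re.mulInt k, A.im.mulInt k⟩
/-- Division by a positive natural. [folklore] -/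
def divNat (A : MC) (n : ℕ) : MC := ⟨A.re.divNat n, A.im.divNat n⟩
/-- Enclosure of `|z|²`. [folklore] -/
def normSq (S : ℕ) (A : MC) : MI := (A.re.sqr S).add (A.im.sqr S)
/-- Division `A / B` through `A · conj B / |B|²` (`none` unless `|B|²` is bounded below by a
positive number). [folklore] -/
def divBox (S : ℕ) (A B : MC) : Option MC :=
  let n := normSq S B
  let num := mul S A (conj B)
  match num.re.divPos S n, num.im.divPos S n with
  | some r, some i => some ⟨r, i⟩
  | _, _ => none
/-- Widening of both parts. [folklore] -/
def widen (A : MC) (e : ℤ) : MC := ⟨A.re.widen e, A.im.widen e⟩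
/-- `(|re| + |im|) · S` upper bound, a cheap bound for `‖z‖ · S`. [folklore] -/
def absHi (A : MC) : ℤ := A.re.absHi + A.im.absHi

variable {S : ℕ} {z w : ℂ} {A B : MC}

/-- [folklore] -/
theorem mem_ofMI {x : ℝ} {I : MI} (hx : MI.mem S x I) : mem S (x : ℂ) (ofMI S I) := by
  refine ⟨?_, ?_⟩ <;> dsimp only [ofMI]
  · simpa using hx
  · simpa using MI.mem_ofInt S 0

/-- [folklore] -/
theorem mem_ofInt (S : ℕ) (n : ℤ) : mem S (n : ℂ) (ofInt S n) := by
  refine ⟨?_, ?_⟩ <;> dsimp only [ofInt]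
  · simpa using MI.mem_ofInt S n
  · simpa using MI.mem_ofInt S 0

/-- [folklore] -/
theorem mem_mk' {x y : ℝ} {I J : MI} (hx : MI.mem S x I) (hy : MI.mem S y J) :
    mem S (⟨x, y⟩ : ℂ) (mk' I J) := ⟨hx, hy⟩

/-- [folklore] -/
theorem mem_add (hz : mem S z A) (hw : mem S w B) : mem S (z + w) (add A B) := by
  refine ⟨?_, ?_⟩ <;> dsimp only [add]
  · simpa using MI.mem_add hz.1 hw.1
  · simpa using MI.mem_add hz.2 hw.2

/-- [folklore] -/
theorem mem_sub (hz : mem S z A) (hw : mem S w B) : mem S (z - w) (sub A B) := by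
  refine ⟨?_, ?_⟩ <;> dsimp only [sub]
  · simpa using MI.mem_sub hz.1 hw.1
  · simpa using MI.mem_sub hz.2 hw.2

/-- [folklore] -/
theorem mem_neg (hz : mem S z A) : mem S (-z) (neg A) := by
  refine ⟨?_, ?_⟩ <;> dsimp only [neg]
  · simpa using MI.mem_neg hz.1
  · simpa using MI.mem_neg hz.2

/-- [folklore] -/
theorem mem_conj (hz : mem S z A) : mem S (starRingEnd ℂ z) (conj A) := by
  refine ⟨?_, ?_⟩ <;> dsimp only [conj]
  · simpa using hz.1
  · simpa using MI.mem_neg hz.2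

/-- [folklore] -/
theorem mem_mul (hS : 0 < S) (hz : mem S z A) (hw : mem S w B) : mem S (z * w) (mul S A B) := by
  refine ⟨?_, ?_⟩ <;> dsimp only [mul]
  · simpa [Complex.mul_re] using
      MI.mem_sub (MI.mem_mul hS hz.1 hw.1) (MI.mem_mul hS hz.2 hw.2)
  · simpa [Complex.mul_im] using
      MI.mem_add (MI.mem_mul hS hz.1 hw.2) (MI.mem_mul hS hz.2 hw.1)

/-- [folklore] -/
theorem mem_sqr (hS : 0 < S) (hz : mem S z A) : mem S (z ^ 2) (sqr S A) := by
  rw [sq]; exact mem_mul hS hz hz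

/-- [folklore] -/
theorem mem_mulMI (hS : 0 < S) {x : ℝ} {I : MI} (hz : mem S z A) (hx : MI.mem S x I) :
    mem S (z * x) (mulMI S A I) := by
  refine ⟨?_, ?_⟩ <;> dsimp only [mulMI]
  · simpa using MI.mem_mul hS hz.1 hx
  · simpa using MI.mem_mul hS hz.2 hx

/-- [folklore] -/
theorem mem_mulI (hz : mem S z A) : mem S (z * Complex.I) (mulI A) := by
  refine ⟨?_, ?_⟩ <;> dsimp only [mulI]
  · simpa using MI.mem_neg hz.2
  · simpa using hz.1

/-- [folklore] -/
theorem mem_mulNegI (hz : mem S z A) : mem S (z * -Complex.I) (mulNegI A) := by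
  refine ⟨?_, ?_⟩ <;> dsimp only [mulNegI]
  · simpa using hz.2
  · simpa using MI.mem_neg hz.1

/-- [folklore] -/
theorem mem_mulInt (hz : mem S z A) (k : ℤ) : mem S (z * k) (mulInt A k) := by
  refine ⟨?_, ?_⟩ <;> dsimp only [mulInt]
  · simpa using MI.mem_mulInt hz.1 k
  · simpa using MI.mem_mulInt hz.2 k

/-- [folklore] -/
theorem mem_divNat (hz : mem S z A) {n : ℕ} (hn : 0 < n) : mem S (z / n) (divNat A n) := by
  refine ⟨?_, ?_⟩ <;> dsimp only [divNat]
  · simpa [Complex.div_natCast_re] using MI.mem_divNat hz.1 hn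
  · simpa [Complex.div_natCast_im] using MI.mem_divNat hz.2 hn

/-- [folklore] -/
theorem mem_normSq (hS : 0 < S) (hz : mem S z A) : MI.mem S (Complex.normSq z) (normSq S A) := by
  rw [Complex.normSq_apply]
  have := MI.mem_add (MI.mem_sqr hS hz.1) (MI.mem_sqr hS hz.2)
  dsimp only [normSq]
  simpa [sq] using this

/-- [folklore] -/
theorem mem_divBox (hS : 0 < S) {C : MC} (h : divBox S A B = some C) (hz : mem S z A)
    (hw : mem S w B) : mem S (z / w) C := by
  unfold divBox at h
  simp only at h
  split at h
  · rename_i r i hr hi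
    simp only [Option.some.injEq] at h
    subst h
    have hn := mem_normSq hS hw
    have hnum := mem_mul hS hz (mem_conj hw)
    have hpos : 0 < (normSq S B).lo := by
      by_contra hle
      unfold MI.divPos at hr
      rw [if_neg hle] at hr
      simp at hr
    have hw0 : w ≠ 0 := by
      intro h0
      have := MI.pos_of_lo_pos hn hpos
      simp [h0] at this
    have key : z / w = z * starRingEnd ℂ w / (Complex.normSq w : ℂ) := by
      rw [div_eq_mul_inv, Complex.inv_def, Complex.ofReal_inv]; ring
    rw [key]
    refine ⟨?_, ?_⟩
    · have := MI.mem_divPos hS hr hnum.1 hn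
      simpa [Complex.div_ofReal_re] using this
    · have := MI.mem_divPos hS hi hnum.2 hn
      simpa [Complex.div_ofReal_im] using this
  · simp at h

/-- Widening along a norm bound: `z ∈ A`, `‖z' - z‖ · S ≤ e` ⇒ `z' ∈ widen A e`. [folklore] -/
theorem mem_widen (hz : mem S z A) {z' : ℂ} {e : ℤ} (he : ‖z' - z‖ * S ≤ e) :
    mem S z' (widen A e) := by
  have hS0 : (0 : ℝ) ≤ S := by positivity
  refine ⟨?_, ?_⟩ <;> dsimp only [widen]
  · refine MI.mem_widen hz.1 (le_trans ?_ he)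
    have := Complex.abs_re_le_norm (z' - z)
    simp only [Complex.sub_re] at this
    exact mul_le_mul_of_nonneg_right this hS0
  · refine MI.mem_widen hz.2 (le_trans ?_ he)
    have := Complex.abs_im_le_norm (z' - z)
    simp only [Complex.sub_im] at this
    exact mul_le_mul_of_nonneg_right this hS0

/-- [folklore] -/
theorem mem_widen_self (hz : mem S z A) {e : ℤ} (he : 0 ≤ e) : mem S z (widen A e) :=
  mem_widen hz (by simpa using (show (0 : ℝ) ≤ e by exact_mod_cast he))

/-- `‖z‖ · S ≤ absHi A`. [folklore] -/
theorem norm_le_absHi (hz : mem S z A) : ‖z‖ * S ≤ (A.absHi : ℝ) := by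
  have h1 := MI.abs_le_absHi hz.1
  have h2 := MI.abs_le_absHi hz.2
  have h3 : ‖z‖ ≤ |z.re| + |z.im| := Complex.norm_le_abs_re_add_abs_im z
  have hS0 : (0 : ℝ) ≤ S := by positivity
  simp only [absHi, Int.cast_add]
  nlinarith [mul_le_mul_of_nonneg_right h3 hS0]

end MC


/-! ### Iterated squaring -/

namespace MI

/-- Square `k` times: an enclosure of `u^(2^k)`. [folklore] -/
def sqrIter (S : ℕ) : ℕ → MI → MI
  | 0, Y => Y
  | k + 1, Y => sqrIter S k (sqr S Y)

variable {S : ℕ}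

/-- [folklore] -/
theorem mem_sqrIter (hS : 0 < S) {u : ℝ} :
    ∀ (k : ℕ) {Y : MI}, mem S u Y → mem S (u ^ (2 ^ k)) (sqrIter S k Y)
  | 0, Y, h => by simpa [sqrIter] using h
  | k + 1, Y, h => by
    have h2 := mem_sqr hS h
    have := mem_sqrIter hS k h2
    simp only [sqrIter]
    convert this using 1
    rw [← pow_mul, pow_succ, mul_comm]

/-! ### The exponential -/

/-- One run of the Taylor recurrence: from `(term, sum)` enclosing `(x^m/m!, Σ_{j<m} x^j/j!)`
produce the pair for `m + n`. [folklore] -/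
def expStep (S : ℕ) (X : MI) : ℕ → ℕ → MI → MI → MI × MI
  | 0, _, term, sum => (term, sum)
  | n + 1, m, term, sum => expStep S X n (m + 1) ((term.mul S X).divNat (m + 1)) (sum.add term)

/-- Enclosure of `exp x` for an interval `X ∋ x` with `X ⊆ [-1, 1]` (checked: `none`
otherwise): Taylor polynomial of degree `< K` plus the remainder bound `Real.exp_bound`
(`K ≥ 1`, else `none`). [folklore] -/
def expSmallPt (S K : ℕ) (X : MI) : Option MI :=
  if -(S : ℤ) ≤ X.lo ∧ X.hi ≤ S ∧ 0 < K then
    let p := expStep S X K 0 ⟨S, S⟩ ⟨0, 0⟩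
    let e := Numerics.cdiv (p.1.absHi * (K + 1)) K
    some (p.2.widen e)
  else none

/-- Enclosure of `exp x` for a thin (or narrow) `X`, any size: `e^x = (e^{x/2^k})^{2^k}`.
[folklore] -/
def expPt (S K k : ℕ) (X : MI) : Option MI :=
  match expSmallPt S K (X.divNat (2 ^ k)) with
  | some Y => some (sqrIter S k Y)
  | none => none

/-- Enclosure of `exp` on a general interval, by monotonicity from the endpoints. [folklore] -/
def exp (S K k : ℕ) (X : MI) : Option MI :=
  match expPt S K k (lower X), expPt S K k (upper X) with
  | some A, some B => some (span A B)
  | _, _ => none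

variable {x : ℝ} {X : MI}

/-- Invariant of the Taylor recurrence for `exp`. [folklore] -/
lemma expStep_spec (hS : 0 < S) (hx : mem S x X) :
    ∀ (n m : ℕ) (term sum : MI), mem S (x ^ m / m.factorial) term →
      mem S (∑ j ∈ range m, x ^ j / j.factorial) sum →
      mem S (x ^ (m + n) / (m + n).factorial) (expStep S X n m term sum).1 ∧
        mem S (∑ j ∈ range (m + n), x ^ j / j.factorial) (expStep S X n m term sum).2
  | 0, m, term, sum, ht, hs => by simpa [expStep] using And.intro ht hs
  | n + 1, m, term, sum, ht, hs => by
    have ht' : mem S (x ^ (m + 1) / (m + 1).factorial) ((term.mul S X).divNat (m + 1)) := by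
      have h := mem_divNat (mem_mul hS ht hx) (Nat.succ_pos m)
      convert h using 1
      rw [Nat.factorial_succ, pow_succ]
      push_cast
      field_simp
    have hs' : mem S (∑ j ∈ range (m + 1), x ^ j / j.factorial) (sum.add term) := by
      rw [Finset.sum_range_succ]
      exact mem_add hs ht
    have := expStep_spec hS hx n (m + 1) _ _ ht' hs'
    simp only [expStep]
    rwa [show m + (n + 1) = m + 1 + n by ring]

/-- [folklore] -/
theorem mem_expSmallPt (hS : 0 < S) {K : ℕ} {Y : MI} (h : expSmallPt S K X = some Y)
    (hx : mem S x X) : mem S (Real.exp x) Y := by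
  have hSr : (0 : ℝ) < S := by exact_mod_cast hS
  unfold expSmallPt at h
  split_ifs at h with hb
  simp only [Option.some.injEq] at h
  subst h
  obtain ⟨hb1, hb2, hK⟩ := hb
  have habs : |x| ≤ 1 := by
    have h1 : (-(S : ℤ) : ℝ) ≤ x * S := le_trans (by exact_mod_cast hb1) hx.1
    have h2 : x * S ≤ S := le_trans hx.2 (by exact_mod_cast hb2)
    rw [abs_le]
    push_cast at h1
    constructor <;> nlinarith
  have h0 : mem S (x ^ 0 / (0 : ℕ).factorial) (⟨S, S⟩ : MI) := by
    simpa [ofInt] using mem_ofInt S 1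
  have hs0 : mem S (∑ j ∈ range 0, x ^ j / j.factorial) (⟨0, 0⟩ : MI) := by
    simpa [ofInt] using mem_ofInt S 0
  obtain ⟨hterm, hsum⟩ := expStep_spec hS hx K 0 _ _ h0 hs0
  simp only [zero_add] at hterm hsum
  set p := expStep S X K 0 ⟨S, S⟩ ⟨0, 0⟩ with hp
  clear_value p
  apply mem_widen hsum
  have hb := Real.exp_bound habs (n := K) hK
  have hT := abs_le_absHi hterm
  rw [abs_div, abs_pow, Nat.abs_cast] at hT
  have hKr : (0 : ℝ) < K := by exact_mod_cast hK
  have hrem : |Real.exp x - ∑ j ∈ range K, x ^ j / j.factorial| * S ≤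
      ((p.1.absHi : ℝ) * (K + 1)) / K := by
    have hfac : (0 : ℝ) < (K.factorial : ℝ) := by positivity
    have hT' : |x| ^ K * S ≤ (p.1.absHi : ℝ) * K.factorial := by
      rw [div_mul_eq_mul_div, div_le_iff₀ hfac] at hT; exact hT
    calc |Real.exp x - ∑ j ∈ range K, x ^ j / j.factorial| * S
        ≤ |x| ^ K * ((K.succ : ℝ) * ((K.factorial : ℝ) * K)⁻¹) * S :=
          mul_le_mul_of_nonneg_right hb hSr.le
      _ = (|x| ^ K * S) * (K + 1) / (K.factorial * K) := by
          push_cast; ring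
      _ ≤ ((p.1.absHi : ℝ) * K.factorial) * (K + 1) / (K.factorial * K) := by gcongr
      _ = _ := by field_simp
  refine hrem.trans ?_
  have hKz : (0 : ℤ) < K := by exact_mod_cast hK
  have := Numerics.div_le_cdiv (a := p.1.absHi * (K + 1)) (b := K) hKz
  push_cast at this
  exact this

/-- [folklore] -/
theorem mem_expPt (hS : 0 < S) {K k : ℕ} {Y : MI} (h : expPt S K k X = some Y)
    (hx : mem S x X) : mem S (Real.exp x) Y := by
  unfold expPt at h
  split at h
  · rename_i Z hZ
    simp only [Option.some.injEq] at h
    subst h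
    have h2k : (0 : ℕ) < 2 ^ k := pow_pos (by norm_num) k
    have h1 := mem_expSmallPt hS hZ (mem_divNat hx h2k)
    have h2 := mem_sqrIter hS k h1
    convert h2 using 1
    rw [← Real.exp_nat_mul]
    congr 1
    push_cast
    field_simp
  · simp at h

/-- [folklore] -/
theorem mem_exp (hS : 0 < S) {K k : ℕ} {Y : MI} (h : exp S K k X = some Y) (hx : mem S x X) :
    mem S (Real.exp x) Y := by
  unfold exp at h
  split at h
  · rename_i A B hA hB
    simp only [Option.some.injEq] at h
    subst h
    have h1 := mem_expPt hS hA (mem_lower hS X)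
    have h2 := mem_expPt hS hB (mem_upper hS X)
    exact mem_span h1 h2 (Real.exp_le_exp.2 (lo_div_le hS hx)) (Real.exp_le_exp.2 (le_hi_div hS hx))
  · simp at h

/-! ### `log (1 - x)` for `0 ≤ x ≤ 1/2`, `log 2`, `log n` -/

/-- The recurrence for `Σ_{i<n} x^{i+1}/(i+1)`: `(pow, sum) = (x^{i+1}, Σ_{j<i} x^{j+1}/(j+1))`.
[folklore] -/
def logStep (S : ℕ) (X : MI) : ℕ → ℕ → MI → MI → MI × MI
  | 0, _, pow, sum => (pow, sum)
  | n + 1, i, pow, sum => logStep S X n (i + 1) (pow.mul S X) (sum.add (pow.divNat (i + 1)))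

/-- Enclosure of `log (1 - x)` for an interval `X ⊆ [0, 1/2]` (`none` otherwise), from `K`
terms of the series and the tail bound `Real.abs_log_sub_add_sum_range_le` (`≤ 2 x^{K+1}`).
[folklore] -/
def logOneSub (S K : ℕ) (X : MI) : Option MI :=
  if 0 ≤ X.lo ∧ 2 * X.hi ≤ S then
    let p := logStep S X K 0 X ⟨0, 0⟩
    some (p.2.neg.widen (2 * p.1.absHi))
  else none

/-- Enclosure of `log 2 = -log (1 - 1/2)`. [folklore] -/
def logTwo (S K : ℕ) : Option MI :=
  match logOneSub S K (ofFrac S 1 2) with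
  | some Y => some Y.neg
  | none => none

/-- Enclosure of `log n` for a natural number `n ≥ 1`: with `2^k ≤ n < 2^{k+1}`,
`log n = k log 2 - log (1 - (n - 2^k)/n)`. (`none` for `n = 0` or on failure.) [folklore] -/
def logNat (S K : ℕ) (n : ℕ) : Option MI :=
  if n = 0 then none else
    let k := Nat.log 2 n
    match logTwo S K, logOneSub S K (ofFrac S ((n : ℤ) - (2 : ℤ) ^ k) n) with
    | some L2, some Y => some ((L2.mulInt k).sub Y)
    | _, _ => none

/-- Invariant of the series recurrence for `log (1 - x)`. [folklore] -/
lemma logStep_spec (hS : 0 < S) (hx : mem S x X) :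
    ∀ (n i : ℕ) (pow sum : MI), mem S (x ^ (i + 1)) pow →
      mem S (∑ j ∈ range i, x ^ (j + 1) / (j + 1)) sum →
      mem S (x ^ (i + n + 1)) (logStep S X n i pow sum).1 ∧
        mem S (∑ j ∈ range (i + n), x ^ (j + 1) / (j + 1)) (logStep S X n i pow sum).2
  | 0, i, pow, sum, hp, hs => by simpa [logStep] using And.intro hp hs
  | n + 1, i, pow, sum, hp, hs => by
    have hp' : mem S (x ^ (i + 1 + 1)) (pow.mul S X) := by
      rw [pow_succ]; exact mem_mul hS hp hx
    have hs' : mem S (∑ j ∈ range (i + 1), x ^ (j + 1) / (j + 1))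
        (sum.add (pow.divNat (i + 1))) := by
      rw [Finset.sum_range_succ]
      refine mem_add hs ?_
      have := mem_divNat hp (Nat.succ_pos i)
      push_cast at this ⊢
      exact this
    have := logStep_spec hS hx n (i + 1) _ _ hp' hs'
    simp only [logStep]
    rw [show i + (n + 1) = i + 1 + n by ring]
    exact this

/-- [folklore] -/
theorem mem_logOneSub (hS : 0 < S) {K : ℕ} {Y : MI} (h : logOneSub S K X = some Y)
    (hx : mem S x X) : mem S (Real.log (1 - x)) Y := by
  have hSr : (0 : ℝ) < S := by exact_mod_cast hS
  unfold logOneSub at h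
  split_ifs at h with hb
  simp only [Option.some.injEq] at h
  subst h
  have hx0 : 0 ≤ x := by
    have := le_trans (show ((0 : ℤ) : ℝ) ≤ X.lo by exact_mod_cast hb.1) hx.1
    simp at this; nlinarith
  have hx2 : x ≤ 1 / 2 := by
    have h2 : (2 * X.hi : ℝ) ≤ S := by exact_mod_cast hb.2
    nlinarith [hx.2]
  have habs : |x| < 1 := by rw [abs_of_nonneg hx0]; linarith
  obtain ⟨hpow, hsum⟩ := logStep_spec hS hx K 0 X ⟨0, 0⟩ (by simpa using hx)
    (by simpa [ofInt] using mem_ofInt S 0)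
  simp only [zero_add] at hpow hsum
  set p := logStep S X K 0 X ⟨0, 0⟩ with hp
  clear_value p
  apply mem_widen (mem_neg hsum)
  have htail := Real.abs_log_sub_add_sum_range_le habs K
  have hP := abs_le_absHi hpow
  rw [abs_of_nonneg (pow_nonneg hx0 _)] at hP
  have h1 : |x| ^ (K + 1) / (1 - |x|) ≤ 2 * x ^ (K + 1) := by
    rw [abs_of_nonneg hx0, div_le_iff₀ (by linarith)]
    nlinarith [pow_nonneg hx0 (K + 1)]
  have h2 : |Real.log (1 - x) - -∑ j ∈ range K, x ^ (j + 1) / (j + 1)| =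
      |∑ i ∈ range K, x ^ (i + 1) / (i + 1) + Real.log (1 - x)| := by
    rw [sub_neg_eq_add, add_comm]
  rw [h2]
  push_cast
  nlinarith [htail, h1, hP]

/-- [folklore] -/
theorem mem_logTwo (hS : 0 < S) {K : ℕ} {Y : MI} (h : logTwo S K = some Y) :
    mem S (Real.log 2) Y := by
  unfold logTwo at h
  split at h
  · rename_i Z hZ
    simp only [Option.some.injEq] at h
    subst h
    have h1 := mem_logOneSub hS hZ (mem_ofFrac S 1 (q := 2) (by norm_num))
    have e : Real.log (1 - ((1 : ℤ) : ℝ) / (2 : ℕ)) = -Real.log 2 := by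
      push_cast
      rw [show (1 : ℝ) - 1 / 2 = 2⁻¹ by norm_num, Real.log_inv]
    rw [e] at h1
    simpa using mem_neg h1
  · simp at h

/-- [folklore] -/
theorem mem_logNat (hS : 0 < S) {K n : ℕ} {Y : MI} (h : logNat S K n = some Y) :
    mem S (Real.log n) Y := by
  unfold logNat at h
  split_ifs at h with hn
  simp only at h
  split at h
  · rename_i L2 Z hL2 hZ
    simp only [Option.some.injEq] at h
    subst h
    set k := Nat.log 2 n with hk
    have hn1 : 1 ≤ n := Nat.one_le_iff_ne_zero.2 hn
    have hnr : (0 : ℝ) < n := by exact_mod_cast hn1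
    have hpow_le : 2 ^ k ≤ n := Nat.pow_log_le_self 2 hn
    have hlt : n < 2 ^ (k + 1) := Nat.lt_pow_succ_log_self (by norm_num) n
    have h2 := mem_logTwo hS hL2
    have h3 := mem_logOneSub hS hZ (mem_ofFrac S ((n : ℤ) - (2 : ℤ) ^ k) (q := n) hn1)
    -- `1 - (n - 2^k)/n = 2^k / n`
    have e1 : (1 : ℝ) - (((n : ℤ) - (2 : ℤ) ^ k : ℤ) : ℝ) / (n : ℕ) = (2 : ℝ) ^ k / n := by
      push_cast
      field_simp
      ring
    rw [e1, Real.log_div (by positivity) hnr.ne', Real.log_pow] at h3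
    have := mem_sub (mem_mulInt h2 (k : ℤ)) h3
    convert this using 1
    push_cast
    ring
  · simp at h

/-! ### `arctan (1/m)` and `π` -/

/-- The partial sums of Gregory's series for `arctan (1/m)`: accumulate
`Σ_{n<K} (-1)^n / ((2n+1) m^{2n+1})` from exact fractions. Arguments: terms left, current index
`n`, current power `m^{2n+1}`, accumulator. [folklore] -/
def atanStep (S : ℕ) (m : ℕ) : ℕ → ℕ → ℕ → MI → MI
  | 0, _, _, acc => acc
  | j + 1, n, pw, acc =>
      let term := ofFrac S (if n % 2 = 0 then 1 else -1) ((2 * n + 1) * pw)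
      atanStep S m j (n + 1) (pw * (m * m)) (acc.add term)

/-- Enclosure of `arctan (1/m)` for an integer `m ≥ 2`: `K` terms of Gregory's series and the
tail bound `(1/m)^{2K+1}/(1 - 1/m²) ≤ (4/3) / m^{2K+1}`. (`none` if `m < 2`.) [folklore] -/
def atanInv (S K : ℕ) (m : ℕ) : Option MI :=
  if 2 ≤ m then
    some ((atanStep S m K 0 m ⟨0, 0⟩).widen (Numerics.cdiv (4 * (S : ℤ)) (3 * (m : ℤ) ^ (2 * K + 1))))
  else none

/-- Enclosure of `π = 16 arctan (1/5) - 4 arctan (1/239)` (Machin). [folklore] -/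
def pi (S K : ℕ) : Option MI :=
  match atanInv S K 5, atanInv S K 239 with
  | some A, some B => some ((A.mulInt 16).sub (B.mulInt 4))
  | _, _ => none

/-- Invariant of `atanStep`. [folklore] -/
lemma atanStep_spec (S : ℕ) {m : ℕ} (hm : 1 ≤ m) :
    ∀ (j n pw : ℕ) (acc : MI), pw = m ^ (2 * n + 1) →
      mem S (∑ i ∈ range n, (-1 : ℝ) ^ i * ((m : ℝ)⁻¹) ^ (2 * i + 1) / ((2 * i + 1 : ℕ) : ℝ)) acc →
      mem S (∑ i ∈ range (n + j), (-1 : ℝ) ^ i * ((m : ℝ)⁻¹) ^ (2 * i + 1) / ((2 * i + 1 : ℕ) : ℝ))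
        (atanStep S m j n pw acc)
  | 0, n, pw, acc, _, h => by simpa [atanStep] using h
  | j + 1, n, pw, acc, hpw, h => by
    simp only [atanStep]
    rw [show n + (j + 1) = n + 1 + j by ring]
    refine atanStep_spec S hm j (n + 1) _ _ (by rw [hpw]; ring) ?_
    rw [Finset.sum_range_succ]
    refine mem_add h ?_
    have hq : 0 < (2 * n + 1) * pw := by
      rw [hpw]; positivity
    have := mem_ofFrac S (if n % 2 = 0 then 1 else -1) hq
    convert this using 1
    have hmr : (0 : ℝ) < m := by exact_mod_cast hm
    have hmk : (m : ℝ) ^ (2 * n + 1) ≠ 0 := pow_ne_zero _ hmr.ne'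
    rw [hpw, inv_pow]
    rcases Nat.even_or_odd n with he | ho
    · have : n % 2 = 0 := Nat.even_iff.1 he
      rw [if_pos this, he.neg_one_pow]
      push_cast
      field_simp
    · have : n % 2 = 1 := Nat.odd_iff.1 ho
      rw [if_neg (by omega), ho.neg_one_pow]
      push_cast
      field_simp

/-- Tail of Gregory's series: for `0 ≤ x < 1`,
`|arctan x - Σ_{i<K} (-1)^i x^{2i+1}/(2i+1)| ≤ x^{2K+1} / (1 - x²)`. [folklore] -/
lemma abs_arctan_sub_sum_le {x : ℝ} (hx0 : 0 ≤ x) (hx1 : x < 1) (K : ℕ) :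
    |Real.arctan x - ∑ i ∈ range K, (-1 : ℝ) ^ i * x ^ (2 * i + 1) / ((2 * i + 1 : ℕ) : ℝ)| ≤
      x ^ (2 * K + 1) / (1 - x ^ 2) := by
  have hxn : ‖x‖ < 1 := by rw [Real.norm_eq_abs, abs_of_nonneg hx0]; exact hx1
  have hsum := Real.hasSum_arctan hxn
  have htail := (hasSum_nat_add_iff' K).2 hsum
  have hx2 : x ^ 2 < 1 := by nlinarith
  have hgeo : HasSum (fun i : ℕ ↦ x ^ (2 * K + 1) * (x ^ 2) ^ i) (x ^ (2 * K + 1) / (1 - x ^ 2)) := by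
    have := (hasSum_geometric_of_lt_one (sq_nonneg x) hx2).mul_left (x ^ (2 * K + 1))
    simpa [div_eq_mul_inv] using this
  have hle : ∀ i : ℕ, ‖(-1 : ℝ) ^ (i + K) * x ^ (2 * (i + K) + 1) / ((2 * (i + K) + 1 : ℕ) : ℝ)‖ ≤
      x ^ (2 * K + 1) * (x ^ 2) ^ i := by
    intro i
    rw [Real.norm_eq_abs, abs_div, abs_mul, abs_pow, abs_neg, abs_one, one_pow, one_mul,
      abs_of_nonneg (pow_nonneg hx0 _), Nat.abs_cast]
    have hden : (1 : ℝ) ≤ ((2 * (i + K) + 1 : ℕ) : ℝ) := by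
      exact_mod_cast (show 1 ≤ 2 * (i + K) + 1 by omega)
    calc x ^ (2 * (i + K) + 1) / ((2 * (i + K) + 1 : ℕ) : ℝ)
        ≤ x ^ (2 * (i + K) + 1) / 1 :=
          div_le_div_of_nonneg_left (pow_nonneg hx0 _) one_pos hden
      _ = x ^ (2 * K + 1) * (x ^ 2) ^ i := by rw [div_one, ← pow_mul, ← pow_add]; ring_nf
  have := HasSum.norm_le_of_bounded htail hgeo hle
  rw [Real.norm_eq_abs] at this
  exact this

/-- [folklore] -/
theorem mem_atanInv (S : ℕ) {K m : ℕ} {Y : MI} (h : atanInv S K m = some Y) :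
    mem S (Real.arctan ((m : ℝ)⁻¹)) Y := by
  unfold atanInv at h
  split_ifs at h with hm
  simp only [Option.some.injEq] at h
  subst h
  have hm1 : 1 ≤ m := le_trans (by norm_num) hm
  have hmr : (2 : ℝ) ≤ m := by exact_mod_cast hm
  have hmpos : (0 : ℝ) < m := by linarith
  have hsum := atanStep_spec S hm1 K 0 m ⟨0, 0⟩ (by ring) (by simpa [ofInt] using mem_ofInt S 0)
  simp only [zero_add] at hsum
  apply mem_widen hsum
  have hx0 : 0 ≤ (m : ℝ)⁻¹ := by positivity
  have hx1 : (m : ℝ)⁻¹ < 1 := by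
    rw [inv_lt_one_iff₀]; right; linarith
  have htail := abs_arctan_sub_sum_le hx0 hx1 K
  -- `x^{2K+1}/(1-x²) ≤ (4/3)/m^{2K+1}`
  have hb : ((m : ℝ)⁻¹) ^ (2 * K + 1) / (1 - ((m : ℝ)⁻¹) ^ 2) ≤
      4 / (3 * (m : ℝ) ^ (2 * K + 1)) := by
    rw [inv_pow, inv_pow]
    have hm2 : (4 : ℝ) ≤ (m : ℝ) ^ 2 := by nlinarith
    have hmK : (0 : ℝ) < (m : ℝ) ^ (2 * K + 1) := by positivity
    have hden : (0 : ℝ) < 1 - ((m : ℝ) ^ 2)⁻¹ := by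
      have : ((m : ℝ) ^ 2)⁻¹ ≤ 1 / 4 := by
        rw [inv_le_comm₀ (by positivity) (by norm_num)]; linarith
      linarith
    rw [div_le_div_iff₀ hden (by positivity)]
    have e : ((m : ℝ) ^ (2 * K + 1))⁻¹ * (3 * (m : ℝ) ^ (2 * K + 1)) = 3 := by
      field_simp
    rw [e]
    have : ((m : ℝ) ^ 2)⁻¹ ≤ 1 / 4 := by
      rw [inv_le_comm₀ (by positivity) (by norm_num)]; linarith
    nlinarith
  have hSr : (0 : ℝ) ≤ S := by positivity
  have h3 : |Real.arctan ((m : ℝ)⁻¹) -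
      ∑ i ∈ range K, (-1 : ℝ) ^ i * ((m : ℝ)⁻¹) ^ (2 * i + 1) / ((2 * i + 1 : ℕ) : ℝ)| * S ≤
      4 * (S : ℝ) / (3 * (m : ℝ) ^ (2 * K + 1)) := by
    calc _ ≤ 4 / (3 * (m : ℝ) ^ (2 * K + 1)) * S :=
          mul_le_mul_of_nonneg_right (htail.trans hb) hSr
      _ = _ := by ring
  refine h3.trans ?_
  have hq : (0 : ℤ) < 3 * (m : ℤ) ^ (2 * K + 1) := by positivity
  have := Numerics.div_le_cdiv (a := 4 * (S : ℤ)) hq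
  push_cast at this
  exact this

/-- [folklore] -/
theorem mem_pi (S : ℕ) {K : ℕ} {Y : MI} (h : pi S K = some Y) : mem S Real.pi Y := by
  unfold pi at h
  split at h
  · rename_i A B hA hB
    simp only [Option.some.injEq] at h
    subst h
    have h5 := mem_atanInv S hA
    have h239 := mem_atanInv S hB
    have key : Real.pi = Real.arctan ((5 : ℕ) : ℝ)⁻¹ * (16 : ℤ) - Real.arctan ((239 : ℕ) : ℝ)⁻¹ * (4 : ℤ) := by
      have := Real.four_mul_arctan_inv_5_sub_arctan_inv_239
      push_cast
      linarith
    rw [key]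
    exact mem_sub (mem_mulInt h5 16) (mem_mulInt h239 4)
  · simp at h

end MI

/-! ### `e^{iθ}` -/

namespace MC

/-- Square `k` times (complex). [folklore] -/
def sqrIter (S : ℕ) : ℕ → MC → MC
  | 0, Y => Y
  | k + 1, Y => sqrIter S k (sqr S Y)

variable {S : ℕ}

/-- [folklore] -/
theorem mem_sqrIter (hS : 0 < S) {u : ℂ} :
    ∀ (k : ℕ) {Y : MC}, mem S u Y → mem S (u ^ (2 ^ k)) (sqrIter S k Y)
  | 0, Y, h => by simpa [sqrIter] using h
  | k + 1, Y, h => by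
    have h2 := mem_sqr hS h
    have := mem_sqrIter hS k h2
    simp only [sqrIter]
    convert this using 1
    rw [← pow_mul, pow_succ, mul_comm]

/-- Taylor recurrence for `exp (i φ)`, `φ` a real interval: `(term, sum)`. [folklore] -/
def expIStep (S : ℕ) (Φ : MI) : ℕ → ℕ → MC → MC → MC × MC
  | 0, _, term, sum => (term, sum)
  | n + 1, m, term, sum =>
      expIStep S Φ n (m + 1) (((term.mulMI S Φ).mulI).divNat (m + 1)) (sum.add term)

/-- Enclosure of `e^{iφ}` for `Φ ∋ φ` with `Φ ⊆ [-1, 1]`, `K ≥ 1` Taylor terms (`none`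
otherwise). [folklore] -/
def expISmallPt (S K : ℕ) (Φ : MI) : Option MC :=
  if -(S : ℤ) ≤ Φ.lo ∧ Φ.hi ≤ S ∧ 0 < K then
    let p := expIStep S Φ K 0 (ofInt S 1) (ofInt S 0)
    let e := Numerics.cdiv (p.1.absHi * (K + 1)) K
    some (p.2.widen e)
  else none

/-- Enclosure of `{e^{iθ} : θ ∈ Θ}`: reduce `θ₀ = lo Θ` modulo `2π` using the supplied enclosure
`piI ∋ π`, evaluate `e^{iθ₀} = (e^{iθ₀'/2^k})^{2^k}` by Taylor (`K` terms), and widen by the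
width of `Θ` (`|e^{iθ} - e^{iθ₀}| ≤ |θ - θ₀|`). [folklore] -/
def expI (S K k : ℕ) (piI : MI) (Θ : MI) : Option MC :=
  let twoPi := piI.mulInt 2
  if 0 < twoPi.lo then
    let q : ℤ := (2 * Θ.lo + twoPi.lo) / (2 * twoPi.lo)
    let θ₀ : MI := (MI.ofScaled Θ.lo).sub (twoPi.mulInt q)
    let φ : MI := θ₀.divNat (2 ^ k)
    match expISmallPt S K (MI.lower φ) with
    | some A =>
        let w := A.widen (φ.hi - φ.lo)
        let wk := sqrIter S k w
        some (wk.widen (Θ.hi - Θ.lo))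
    | none => none
  else none

variable {φ θ : ℝ} {Φ Θ : MI}

/-- Invariant of the Taylor recurrence for `exp (iφ)`. [folklore] -/
lemma expIStep_spec (hS : 0 < S) (hφ : MI.mem S φ Φ) :
    ∀ (n m : ℕ) (term sum : MC), mem S ((φ * Complex.I) ^ m / m.factorial) term →
      mem S (∑ j ∈ range m, (φ * Complex.I) ^ j / j.factorial) sum →
      mem S ((φ * Complex.I) ^ (m + n) / (m + n).factorial) (expIStep S Φ n m term sum).1 ∧
        mem S (∑ j ∈ range (m + n), (φ * Complex.I) ^ j / j.factorial)
          (expIStep S Φ n m term sum).2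
  | 0, m, term, sum, ht, hs => by simpa [expIStep] using And.intro ht hs
  | n + 1, m, term, sum, ht, hs => by
    have ht' : mem S ((φ * Complex.I) ^ (m + 1) / (m + 1).factorial)
        (((term.mulMI S Φ).mulI).divNat (m + 1)) := by
      have h := mem_divNat (mem_mulI (mem_mulMI hS ht hφ)) (Nat.succ_pos m)
      convert h using 1
      rw [Nat.factorial_succ, pow_succ]
      push_cast
      field_simp
    have hs' : mem S (∑ j ∈ range (m + 1), (φ * Complex.I) ^ j / j.factorial) (sum.add term) := by
      rw [Finset.sum_range_succ]
      exact mem_add hs ht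
    have := expIStep_spec hS hφ n (m + 1) _ _ ht' hs'
    simp only [expIStep]
    rwa [show m + (n + 1) = m + 1 + n by ring]

/-- [folklore] -/
theorem mem_expISmallPt (hS : 0 < S) {K : ℕ} {Y : MC} (h : expISmallPt S K Φ = some Y)
    (hφ : MI.mem S φ Φ) : mem S (Complex.exp (φ * Complex.I)) Y := by
  have hSr : (0 : ℝ) < S := by exact_mod_cast hS
  unfold expISmallPt at h
  split_ifs at h with hb
  simp only [Option.some.injEq] at h
  subst h
  obtain ⟨hb1, hb2, hK⟩ := hb
  have habs : |φ| ≤ 1 := by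
    have h1 : (-(S : ℤ) : ℝ) ≤ φ * S := le_trans (by exact_mod_cast hb1) hφ.1
    have h2 : φ * S ≤ S := le_trans hφ.2 (by exact_mod_cast hb2)
    rw [abs_le]
    push_cast at h1
    constructor <;> nlinarith
  have hnorm : ‖(φ : ℂ) * Complex.I‖ ≤ 1 := by simpa using habs
  have h0 : mem S ((φ * Complex.I) ^ 0 / (0 : ℕ).factorial) (ofInt S 1) := by
    simpa using mem_ofInt S 1
  have hs0 : mem S (∑ j ∈ range 0, (φ * Complex.I) ^ j / j.factorial) (ofInt S 0) := by
    simpa using mem_ofInt S 0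
  obtain ⟨hterm, hsum⟩ := expIStep_spec hS hφ K 0 _ _ h0 hs0
  simp only [zero_add] at hterm hsum
  set p := expIStep S Φ K 0 (ofInt S 1) (ofInt S 0) with hp
  clear_value p
  apply mem_widen hsum
  have hb' := Complex.exp_bound hnorm (n := K) hK
  have hT := norm_le_absHi hterm
  rw [norm_div, norm_pow, Complex.norm_natCast] at hT
  have hfac : (0 : ℝ) < (K.factorial : ℝ) := by positivity
  have hKr : (0 : ℝ) < K := by exact_mod_cast hK
  have hT' : ‖(φ : ℂ) * Complex.I‖ ^ K * S ≤ (p.1.absHi : ℝ) * K.factorial := by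
    rw [div_mul_eq_mul_div, div_le_iff₀ hfac] at hT; exact hT
  have hrem : ‖Complex.exp (φ * Complex.I) -
      ∑ j ∈ range K, (φ * Complex.I) ^ j / j.factorial‖ * S ≤
      ((p.1.absHi : ℝ) * (K + 1)) / K := by
    calc _ ≤ ‖(φ : ℂ) * Complex.I‖ ^ K *
          ((K.succ : ℝ) * ((K.factorial : ℝ) * K)⁻¹) * S :=
          mul_le_mul_of_nonneg_right hb' hSr.le
      _ = (‖(φ : ℂ) * Complex.I‖ ^ K * S) * (K + 1) / (K.factorial * K) := by push_cast; ring
      _ ≤ ((p.1.absHi : ℝ) * K.factorial) * (K + 1) / (K.factorial * K) := by gcongr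
      _ = _ := by field_simp
  refine hrem.trans ?_
  have hKz : (0 : ℤ) < K := by exact_mod_cast hK
  have := Numerics.div_le_cdiv (a := p.1.absHi * (K + 1)) (b := K) hKz
  push_cast at this
  exact this

/-- [folklore] -/
theorem mem_expI (hS : 0 < S) {K k : ℕ} {piI : MI} (hpi : MI.mem S Real.pi piI) {Y : MC}
    (h : expI S K k piI Θ = some Y) (hθ : MI.mem S θ Θ) :
    mem S (Complex.exp (θ * Complex.I)) Y := by
  have hSr : (0 : ℝ) < S := by exact_mod_cast hS
  have hSne : (S : ℝ) ≠ 0 := hSr.ne'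
  unfold expI at h
  simp only at h
  split_ifs at h with hpos
  split at h
  · rename_i A hA
    simp only [Option.some.injEq] at h
    subst h
    -- notation
    set twoPi := piI.mulInt 2 with htwoPi
    set q : ℤ := (2 * Θ.lo + twoPi.lo) / (2 * twoPi.lo) with hq
    set θ₀I : MI := (MI.ofScaled Θ.lo).sub (twoPi.mulInt q) with hθ₀I
    set φI : MI := θ₀I.divNat (2 ^ k) with hφI
    -- the reduced angle
    set θ₀ : ℝ := (Θ.lo : ℝ) / S with hθ₀
    set ψ : ℝ := θ₀ - 2 * Real.pi * q with hψ
    have hψmem : MI.mem S ψ θ₀I := by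
      have h1 := MI.mem_ofScaled hS Θ.lo
      have h2 : MI.mem S (2 * Real.pi * q) (twoPi.mulInt q) := by
        have := MI.mem_mulInt (MI.mem_mulInt hpi 2) q
        push_cast at this
        rw [htwoPi]
        convert this using 1; ring
      exact MI.mem_sub h1 h2
    have h2k : (0 : ℕ) < 2 ^ k := pow_pos (by norm_num) k
    have hφmem : MI.mem S (ψ / (2 ^ k : ℕ)) φI := MI.mem_divNat hψmem h2k
    -- `e^{iψ/2^k}` from the thin evaluation at `lo φI` and the width of `φI`
    have hA' := mem_expISmallPt hS hA (MI.mem_lower hS φI)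
    have hkey : mem S (Complex.exp ((ψ / (2 ^ k : ℕ) : ℝ) * Complex.I)) (A.widen (φI.hi - φI.lo)) := by
      apply mem_widen hA'
      refine le_trans (mul_le_mul_of_nonneg_right (Literature.Analysis.ValidatedNumerics.Numerics.CB.norm_exp_I_sub_exp_I_le _ _) hSr.le) ?_
      have h1 := hφmem.1
      have h2 := hφmem.2
      rw [abs_of_nonneg (by rw [sub_nonneg, div_le_iff₀ hSr]; exact h1)]
      rw [sub_mul, div_mul_cancel₀ _ hSne]
      push_cast at h1 h2 ⊢
      linarith
    -- `2^k`-th power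
    have h4 : mem S (Complex.exp ((ψ : ℝ) * Complex.I)) (sqrIter S k (A.widen (φI.hi - φI.lo))) := by
      have := mem_sqrIter hS k hkey
      convert this using 1
      rw [← Complex.exp_nat_mul]
      congr 1; push_cast; field_simp
    -- `e^{iψ} = e^{iθ₀}`
    have hper : Complex.exp ((ψ : ℝ) * Complex.I) = Complex.exp ((θ₀ : ℝ) * Complex.I) := by
      rw [hψ]
      push_cast
      rw [sub_mul, Complex.exp_sub, show (2 * (Real.pi : ℂ) * (q : ℂ)) * Complex.I =
        (q : ℂ) * (2 * Real.pi * Complex.I) by ring, Complex.exp_int_mul_two_pi_mul_I, div_one]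
    rw [hper] at h4
    -- widen by the width of `Θ`
    apply mem_widen h4
    refine le_trans (mul_le_mul_of_nonneg_right (Literature.Analysis.ValidatedNumerics.Numerics.CB.norm_exp_I_sub_exp_I_le _ _) hSr.le) ?_
    rw [abs_of_nonneg (by rw [sub_nonneg, hθ₀, div_le_iff₀ hSr]; exact hθ.1)]
    rw [sub_mul, hθ₀, div_mul_cancel₀ _ hSne]
    push_cast
    linarith [hθ.2]
  · simp at h

end MC

end Literature.Analysis.ValidatedNumerics.NumericsMP
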